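import Summits.QuantumFields.YangMills.Theorems.UnitScaleTiltFluctuationComparisonRegPrSmallFieldEnvelope

/-!
# Route `UnitScaleTilt` — crux K1bR-pr `FluctuationComparisonRegPr` (stmt-QuantumFields-19201), stub `stub_logComparisonRegPr`,
# layer S-D/β′ «ENVELOPE FRAME WITHIN SUB-WINDOWS»: the sandwich propagation of the sibling file with the LOWER envelopes asked only on
# prescribed measurable SUB-WINDOWS `S_j ⊆ {PlaqSmall θ(K−j)}` (support file `--supports stmt-QuantumFields-19201`; the stub stays open)

Fleet lead `ym-ust-19201-p1` (gen 1).  WHY (this seat's FINDING `FINDING-19201-edgeband-kappamin.md`, evidence #54 on the item, kit j257288/j257395/j257483/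
j257577): at block sizes `L = 3, 5` the lower one-step envelope `ℓ_{j+1} ≤ T_j(χ_j ℓ_j)` CANNOT hold on the whole next window — on its EDGE BAND the fibre law's mean leaves
the finer window (sup-norm gain of the action-minimising lift × √L = 1.66, 1.08 at the first step) and the restricted density is `e^{−c·p(g)²}`-suppressed; [Balaban1985UV3] (47)
p.267 accordingly carries a characteristic function `χ_k` of a window on the MINIMISER in the lower bound only.  The honest frame therefore lets the LOWER envelopes live on sub-windows
`S_j` (print's `{χ_j^{low} = 1}`, or a shrunken window `{PlaqSmall θ(K−j)/C}`) while the UPPER envelopes stay on the full windows: positivity of `T_j` propagates `ℓ_j·1_{S_j} ≤ τ_j·1_{S_j} ≤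
τ_j·χ_j` through one transformation exactly as before (`T_j(1_{S_j} ℓ_j) ≤ T_j(χ_j τ_j) = τ_{j+1}`).  Nothing of Bałaban's is asserted; the one-step envelopes remain hypotheses on EXPLICIT
functions and sets.

* `sandwich_within_of_oneStep`: lower envelopes on `S_j`, upper on `{PlaqSmall θ(K−j)}`, from an arbitrary integrable `ρ₀ ≥ 0`.
* `heightDensity_sandwich_within_of_oneStep` (run `K`, `ρ₀ = e^{−β_K A}`) at the comparison height: lower bound for a.e. `V` with `fieldShift V ∈ S_{K−n}`, upper bound on the window.

References: T. Bałaban, CMP 102 (1985) 255–275 [Balaban1985UV3] ((41) p.266, (47) p.267).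
-/

noncomputable section

open MeasureTheory Filter Topology
open Literature.MathematicalPhysics.QuantumFieldTheory.Balaban1983to89
open Literature.MathematicalPhysics.QuantumFieldTheory.Balaban1983to89.T3ContinuumYM3Torus
open Literature.MathematicalPhysics.QuantumFieldTheory.Balaban1983to89.T3LevelShift
open Literature.MathematicalPhysics.QuantumFieldTheory.Balaban1983to89.T3UnitLawDensityEML
open Literature.MathematicalPhysics.QuantumFieldTheory.Balaban1983to89.T3UnitScaleTilt
open Literature.MathematicalPhysics.QuantumFieldTheory.Balaban1983to89.T3RestrictedUnitDensity
open Literature.MathematicalPhysics.QuantumFieldTheory.Balaban1983to89.T3TiltDescent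
open Literature.MathematicalPhysics.QuantumFieldTheory.Balaban1983to89.T3CruxEstimates
open Literature.MathematicalPhysics.QuantumFieldTheory.Balaban1983to89.Missing
open Literature.MathematicalPhysics.QuantumFieldTheory.Balaban1983to89.T4Continuum
open Summit.QuantumFields.YangMills.Theorems.LogComparisonSmallFieldRecursion
open Summit.QuantumFields.YangMills.Theorems.LogComparisonSmallFieldEnvelope

namespace Summit.QuantumFields.YangMills.Theorems.LogComparisonSmallFieldEnvelopeWithin

section Frame

variable (F : T3Family) (K : ℕ) (θ : ℕ → ℝ) {ρ₀ : Density (F.P K) 0 (Matrix.specialUnitaryGroup (Fin 2) ℂ)}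
  (S : (j : ℕ) → Set (GaugeField (F.P K) j (Matrix.specialUnitaryGroup (Fin 2) ℂ)))
  (ℓ u : (j : ℕ) → Density (F.P K) j (Matrix.specialUnitaryGroup (Fin 2) ℂ))

/-- **SANDWICH PROPAGATION WITH LOWER ENVELOPES ON SUB-WINDOWS**: as `LogComparisonSmallFieldEnvelope.sandwich_of_oneStep`, but the lower envelope `ℓ_j` is
asked (base and conclusion) only on a measurable sub-window `S_j ⊆ {PlaqSmall θ(K−j)}`, and the lower one-step hypothesis reads `ℓ_{j+1} ≤ T_j(1_{S_j}·ℓ_j)` a.e. on `S_{j+1}` (the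
fibre integral restricted to the sub-window — print's lower-bound recursion (47) with its own characteristic functions); the upper envelopes are unchanged.  THEN for every
`j ≤ k`: `ℓ_j ≤ τ_j[ρ₀]` a.e. on `S_j` and `τ_j[ρ₀] ≤ u_j` a.e. on the window. [cite: Balaban1985UV3, (41) p.266 and (47) p.267] -/
theorem sandwich_within_of_oneStep (h0 : ∀ U, 0 ≤ ρ₀ U) (hi : Integrable ρ₀ (fieldMeasure (F.P K) 0 (Matrix.specialUnitaryGroup (Fin 2) ℂ)))
    {k : ℕ} (hk : k ≤ K) (hSm : ∀ j, MeasurableSet (S j))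
    (hSsub : ∀ j, j ≤ k → S j ⊆ {W | PlaqSmall (θ (K - j)) W})
    (hℓi : ∀ j, j ≤ k → Integrable (ℓ j) (fieldMeasure (F.P K) j (Matrix.specialUnitaryGroup (Fin 2) ℂ)))
    (hui : ∀ j, j ≤ k → Integrable (u j) (fieldMeasure (F.P K) j (Matrix.specialUnitaryGroup (Fin 2) ℂ)))
    (hbaseℓ : ∀ᵐ W ∂fieldMeasure (F.P K) 0 (Matrix.specialUnitaryGroup (Fin 2) ℂ), W ∈ S 0 → ℓ 0 W ≤ ρ₀ W)
    (hbaseu : ∀ᵐ W ∂fieldMeasure (F.P K) 0 (Matrix.specialUnitaryGroup (Fin 2) ℂ), PlaqSmall (θ K) W → ρ₀ W ≤ u 0 W)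
    (hstepℓ : ∀ (j : ℕ) (hj : j + 1 ≤ k), ∀ᵐ W ∂fieldMeasure (F.P K) (j + 1) (Matrix.specialUnitaryGroup (Fin 2) ℂ),
      W ∈ S (j + 1) → ℓ (j + 1) W ≤ (rt F K j (by omega)).T ((S j).indicator (ℓ j)) W)
    (hstepu : ∀ (j : ℕ) (hj : j + 1 ≤ k), ∀ᵐ W ∂fieldMeasure (F.P K) (j + 1) (Matrix.specialUnitaryGroup (Fin 2) ℂ),
      PlaqSmall (θ (K - (j + 1))) W → (rt F K j (by omega)).T ({W' | PlaqSmall (θ (K - j)) W'}.indicator (u j)) W ≤ u (j + 1) W) :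
    ∀ j, j ≤ k →
      (∀ᵐ W ∂fieldMeasure (F.P K) j (Matrix.specialUnitaryGroup (Fin 2) ℂ), W ∈ S j →
        ℓ j W ≤ towerDensity F K ((histGood F ℰp θ K (K - j + 1)).indicator ρ₀) j W) ∧
      (∀ᵐ W ∂fieldMeasure (F.P K) j (Matrix.specialUnitaryGroup (Fin 2) ℂ), PlaqSmall (θ (K - j)) W →
        towerDensity F K ((histGood F ℰp θ K (K - j + 1)).indicator ρ₀) j W ≤ u j W) := by
  intro j
  induction j with
  | zero =>
    intro _
    rw [Nat.sub_zero, towerDensity_histGood_zero_eq F K θ ρ₀]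
    exact ⟨hbaseℓ, hbaseu⟩
  | succ j ih =>
    intro hj
    have hjk : j ≤ k := by omega
    have hj1 : j + 1 ≤ F.m + K := by omega
    have hKj : K - j + j = K := by omega
    obtain ⟨ihℓ, ihu⟩ := ih hjk
    have hχ : MeasurableSet {W' : GaugeField (F.P K) j (Matrix.specialUnitaryGroup (Fin 2) ℂ) | PlaqSmall (θ (K - j)) W'} :=
      measurableSet_plaqSmall _
    have hS' : MeasurableSet (histGood F ℰp θ K (K - j + 1) :
        Set (GaugeField (F.P K) 0 (Matrix.specialUnitaryGroup (Fin 2) ℂ))) :=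
      measurableSet_histGood F ℰp measurableE_ℰp θ K _
    have hτ0 : ∀ W, 0 ≤ towerDensity F K ((histGood F ℰp θ K (K - j + 1)).indicator ρ₀) j W :=
      towerDensity_nonneg F K (fun U => Set.indicator_nonneg (fun U _ => h0 U) U) j
    have hτi : Integrable (towerDensity F K ((histGood F ℰp θ K (K - j + 1)).indicator ρ₀) j)
        (fieldMeasure (F.P K) j (Matrix.specialUnitaryGroup (Fin 2) ℂ)) :=
      integrable_towerDensity F K (hi.indicator hS') j (by omega)
    -- lower: 1_{S_j} ℓ_j ≤ 1_{S_j} τ_j ≤ χ_j τ_j a.e.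
    have hle₁ : (S j).indicator (ℓ j) ≤ᵐ[fieldMeasure (F.P K) j (Matrix.specialUnitaryGroup (Fin 2) ℂ)]
        {W' | PlaqSmall (θ (K - j)) W'}.indicator (towerDensity F K ((histGood F ℰp θ K (K - j + 1)).indicator ρ₀) j) :=
      ihℓ.mono fun W hW => by
        by_cases hWs : W ∈ S j
        · have hWw : PlaqSmall (θ (K - j)) W := hSsub j hjk hWs
          rw [Set.indicator_of_mem hWs, Set.indicator_of_mem hWw]
          exact hW hWs
        · rw [Set.indicator_of_notMem hWs]
          exact Set.indicator_nonneg (fun W _ => hτ0 W) W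
    -- upper: χ_j τ_j ≤ χ_j u_j a.e.
    have hle₂ : {W' | PlaqSmall (θ (K - j)) W'}.indicator (towerDensity F K ((histGood F ℰp θ K (K - j + 1)).indicator ρ₀) j)
          ≤ᵐ[fieldMeasure (F.P K) j (Matrix.specialUnitaryGroup (Fin 2) ℂ)]
        {W' | PlaqSmall (θ (K - j)) W'}.indicator (u j) :=
      ihu.mono fun W hW => by
        by_cases hWs : PlaqSmall (θ (K - j)) W
        · rw [Set.indicator_of_mem hWs, Set.indicator_of_mem hWs]
          exact hW hWs
        · rw [Set.indicator_of_notMem hWs, Set.indicator_of_notMem hWs]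
    have hT₁ := rt_mono_ae F K hj1 ((hℓi j hjk).indicator (hSm j)) (hτi.indicator hχ) hle₁
    have hT₂ := rt_mono_ae F K hj1 (hτi.indicator hχ) ((hui j hjk).indicator hχ) hle₂
    have hrec := towerDensity_histGood_succ_eq_rt_indicator F K θ h0 hi (n := K - j) (j := j) hKj hj1
    have e : K - (j + 1) + 1 = K - j := by omega
    rw [e, hrec]
    refine ⟨?_, ?_⟩
    · filter_upwards [hT₁, hstepℓ j hj] with W h1 hs hWs
      exact (hs hWs).trans h1
    · filter_upwards [hT₂, hstepu j hj] with W h2 hs hWs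
      exact h2.trans (hs hWs)

end Frame

section Height

variable (F : T3Family) {γ : ℝ} (hγ : 0 ≤ γ) (K : ℕ) (θ : ℕ → ℝ)
  (S : (j : ℕ) → Set (GaugeField (F.P K) j (Matrix.specialUnitaryGroup (Fin 2) ℂ)))
  (ℓ u : (j : ℕ) → Density (F.P K) j (Matrix.specialUnitaryGroup (Fin 2) ℂ))

include hγ

/-- **RUN `K` AT THE COMPARISON HEIGHT, LOWER BOUND ON THE SUB-WINDOW**: under the hypotheses of `sandwich_within_of_oneStep` with `k = K − n` and `ρ₀ = e^{−β_K A}`, for a.e. `V` on the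
comparison lattice: if `fieldShift V ∈ S_{K−n}` then `ℓ_k(fieldShift V) ≤ heightDensity F γ _ (histGood θ K n) V`, and if `PlaqSmall θ(n) V` then `heightDensity … V ≤ u_k(fieldShift V)`.
[cite: Balaban1985UV3, (41) p.266 and (47) p.267] -/
theorem heightDensity_sandwich_within_of_oneStep {n : ℕ} (hK : n ≤ K) (hSm : ∀ j, MeasurableSet (S j))
    (hSsub : ∀ j, j ≤ K - n → S j ⊆ {W | PlaqSmall (θ (K - j)) W})
    (hℓi : ∀ j, j ≤ K - n → Integrable (ℓ j) (fieldMeasure (F.P K) j (Matrix.specialUnitaryGroup (Fin 2) ℂ)))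
    (hui : ∀ j, j ≤ K - n → Integrable (u j) (fieldMeasure (F.P K) j (Matrix.specialUnitaryGroup (Fin 2) ℂ)))
    (hbaseℓ : ∀ᵐ W ∂fieldMeasure (F.P K) 0 (Matrix.specialUnitaryGroup (Fin 2) ℂ), W ∈ S 0 → ℓ 0 W ≤ boltzmann (F.P K) ((F.scheme ℰp γ).β K) W)
    (hbaseu : ∀ᵐ W ∂fieldMeasure (F.P K) 0 (Matrix.specialUnitaryGroup (Fin 2) ℂ), PlaqSmall (θ K) W → boltzmann (F.P K) ((F.scheme ℰp γ).β K) W ≤ u 0 W)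
    (hstepℓ : ∀ (j : ℕ) (hj : j + 1 ≤ K - n), ∀ᵐ W ∂fieldMeasure (F.P K) (j + 1) (Matrix.specialUnitaryGroup (Fin 2) ℂ),
      W ∈ S (j + 1) → ℓ (j + 1) W ≤ (rt F K j (by omega)).T ((S j).indicator (ℓ j)) W)
    (hstepu : ∀ (j : ℕ) (hj : j + 1 ≤ K - n), ∀ᵐ W ∂fieldMeasure (F.P K) (j + 1) (Matrix.specialUnitaryGroup (Fin 2) ℂ),
      PlaqSmall (θ (K - (j + 1))) W → (rt F K j (by omega)).T ({W' | PlaqSmall (θ (K - j)) W'}.indicator (u j)) W ≤ u (j + 1) W) :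
    ∀ᵐ V ∂fieldMeasure (F.P n) 0 (Matrix.specialUnitaryGroup (Fin 2) ℂ),
      (fieldShift (F.sitesPerDir_eq (m := F.m) (K := K) (j := K - n) (m' := F.m) (K' := n) (j' := 0) (by omega)) V ∈ S (K - n) →
        ℓ (K - n) (fieldShift (F.sitesPerDir_eq (m := F.m) (K := K) (j := K - n) (m' := F.m) (K' := n) (j' := 0) (by omega)) V) ≤
          heightDensity F γ hK (histGood F ℰp θ K n) V) ∧
      (PlaqSmall (θ n) V → heightDensity F γ hK (histGood F ℰp θ K n) V ≤
          u (K - n) (fieldShift (F.sitesPerDir_eq (m := F.m) (K := K) (j := K - n) (m' := F.m) (K' := n) (j' := 0) (by omega)) V)) := by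
  have hup := F.sitesPerDir_eq (m := F.m) (K := K) (j := K - n) (m' := F.m) (K' := n) (j' := 0) (by omega)
  obtain ⟨hswℓ, hswu⟩ := sandwich_within_of_oneStep F K θ S ℓ u (fun U => (boltzmann_pos _ _ U).le)
    (integrable_boltzmann RegularGaugeGroup.measurable_reTr _ (F.scheme_β_nonneg ℰp hγ K))
    (k := K - n) (Nat.sub_le K n) hSm hSsub hℓi hui hbaseℓ hbaseu hstepℓ hstepu (K - n) le_rfl
  rw [show K - (K - n) = n by omega] at hswu
  have hStop : S (K - n) ⊆ {W | PlaqSmall (θ n) W} := by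
    have h := hSsub (K - n) le_rfl
    rwa [show K - (K - n) = n by omega] at h
  have hq : Measure.QuasiMeasurePreserving
      (fieldShift hup : GaugeField (F.P n) 0 (Matrix.specialUnitaryGroup (Fin 2) ℂ) → GaugeField (F.P K) (K - n) (Matrix.specialUnitaryGroup (Fin 2) ℂ))
      (fieldMeasure (F.P n) 0 (Matrix.specialUnitaryGroup (Fin 2) ℂ)) (fieldMeasure (F.P K) (K - n) (Matrix.specialUnitaryGroup (Fin 2) ℂ)) :=
    (measurePreserving_fieldShift hup).quasiMeasurePreserving
  rw [show K - (K - n) + 1 = n + 1 by omega] at hswℓ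
  filter_upwards [hq.ae hswℓ, hq.ae hswu, heightDensity_histGood_eq_on_window F K θ hγ hK] with V hVℓ hVu hW
  refine ⟨fun hs => ?_, fun hs => ?_⟩
  · have hwin : PlaqSmall (θ n) V := (plaqSmall_fieldShift F hup _ V).mp (hStop hs)
    rw [hW hwin]
    exact hVℓ hs
  · rw [hW hs]
    exact hVu ((plaqSmall_fieldShift F hup _ V).mpr hs)

end Height

end Summit.QuantumFields.YangMills.Theorems.LogComparisonSmallFieldEnvelopeWithin

end
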